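import Mathlib
import HarnessLib
import Summits.Ventures.LatticeQCDFlow.Scoring.UStatisticRowMeans

/-!
# Sen's variance estimator under a PLUG-IN kernel: linearity of the row deviations in the kernel,
# the perturbation bound `|V̂(f + t·g) − V̂(f)| ≤ 2|t|√(V̂(f)V̂(g)) + t²V̂(g)`, scaling, and the
# transfer "`V̂(f) → ζ`, `V̂(g) → ζ'` in probability, `t → 0` a.s. ⇒ `V̂(f + t·g) → ζ` in
# probability"

HONEST FRAMING: exact (Metropolis-corrected) sampling algorithms for lattice gauge theory;
figures of merit are autocorrelation/cost numbers at stated couplings and volumes; no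
continuum-physics claim.

Venture `LatticeQCDFlow` (cell pub-lqcd), topic `Scoring`; FANOUT row 4 (`s0-u1-b`, rung S0-B).
Support file between `Scoring/UStatisticVarianceEstimator` (Sen's `V̂ₙ → ζ₁` in probability
for a FIXED kernel) and the studentised CLT for the printed acceptance ratio, whose kernel
`min(w, w′) − (acc/2)(w + w′)` is only available with the unknown `acc` replaced by the printed
ratio `Rₙ` — a RANDOM, data-dependent kernel `f + tₙ·g` with `f` the true kernel, `g = w + w′`
and `tₙ = (acc − Rₙ)/2 → 0` almost surely.  The row deviations `Dᵢ(f) = Ĥᵢ(f) − U(f)` are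
LINEAR in the kernel, so `V̂(f + t·g) = (1/n)Σᵢ(Dᵢ(f) + t·Dᵢ(g))²` and the Cauchy–Schwarz
perturbation bound of `Scoring/UStatisticRowMeans` (`abs_meanSq_add_sub_meanSq_le`, imported)
controls `V̂(f + t·g) − V̂(f)`; the subsequence criterion for convergence in probability
(`exists_seq_tendstoInMeasure_atTop_iff`, nested twice) turns the deterministic bound into the
transfer theorem **`tendstoInMeasure_senVariance_perturb`**, stated for abstract random
sequences so that the next file only has to supply its four inputs.  NEW WORK of the cell
(elementary); no definition is introduced; nothing is cited.

## Content (`U(f) = Σ_{i≠j} f_{ij}/(n(n−1))`, `Ĥᵢ(f) = Σ_{j≠i} f_{ij}/(n−1)`,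
## `V̂(f) = Σᵢ (Ĥᵢ(f) − U(f))²/n`; kernels `e = f + t·g` entrywise)

§1 `rowDev_add_smul` (linearity), **`senVariance_add_smul_sub_le`**
(`|V̂(e) − V̂(f)| ≤ 2√(V̂(f)·t²V̂(g)) + t²V̂(g)`), `rowDev_smul`, `senVariance_smul`
(`V̂(c·f) = c²V̂(f)`),
`senVariance_nonneg`, `tendsto_senVariance_perturb_along` (the real-analysis squeeze).
§2 **`tendstoInMeasure_senVariance_perturb`** — `Vf → ζ`, `Vg → ζ'` in probability, `T → 0`
almost surely, `|W − Vf| ≤ 2√(Vf·T²Vg) + T²Vg` pointwise, `W` measurable ⇒ `W → ζ` in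
probability.

NOT CLAIMED: rates; random perturbations that do not vanish; any number of ours re-scored.
-/

noncomputable section

namespace Summit.Ventures.LatticeQCDFlow.Scoring.CardConsistency

open MeasureTheory ProbabilityTheory Finset Real Filter
open scoped Topology Function

/-! ## §1 Deterministic: linearity, perturbation, scaling -/

section Deterministic

variable {n : ℕ}

/-- **The row deviations are linear in the kernel**: for `e = f + t·g` entrywise,
`Ĥᵢ(e) − U(e) = (Ĥᵢ(f) − U(f)) + t·(Ĥᵢ(g) − U(g))`. [ours] -/
theorem rowDev_add_smul (f g e : Fin n → Fin n → ℝ) (t : ℝ)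
    (hfg : ∀ i j, e i j = f i j + t * g i j) (i : Fin n) :
    (∑ j ∈ univ.erase i, e i j) / ((n : ℝ) - 1)
        - (∑ z ∈ (univ : Finset (Fin n)).offDiag, e z.1 z.2) / (n * (n - 1) : ℝ)
      = ((∑ j ∈ univ.erase i, f i j) / ((n : ℝ) - 1)
          - (∑ z ∈ (univ : Finset (Fin n)).offDiag, f z.1 z.2) / (n * (n - 1) : ℝ))
        + t * ((∑ j ∈ univ.erase i, g i j) / ((n : ℝ) - 1)
          - (∑ z ∈ (univ : Finset (Fin n)).offDiag, g z.1 z.2) / (n * (n - 1) : ℝ)) := by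
  simp only [hfg, sum_add_distrib, ← mul_sum]
  ring

/-- **Perturbation of Sen's estimator in the kernel** (Cauchy–Schwarz): for `n ≥ 1` and
`e = f + t·g` entrywise, `|V̂(e) − V̂(f)| ≤ 2√(V̂(f)·(t²V̂(g))) + t²V̂(g)`. [ours] -/
theorem senVariance_add_smul_sub_le (hn : 1 ≤ n) (f g e : Fin n → Fin n → ℝ) (t : ℝ)
    (hfg : ∀ i j, e i j = f i j + t * g i j) :
    |(∑ i, ((∑ j ∈ univ.erase i, e i j) / ((n : ℝ) - 1)
          - (∑ z ∈ (univ : Finset (Fin n)).offDiag, e z.1 z.2) / (n * (n - 1) : ℝ)) ^ 2) / (n : ℝ)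
        - (∑ i, ((∑ j ∈ univ.erase i, f i j) / ((n : ℝ) - 1)
          - (∑ z ∈ (univ : Finset (Fin n)).offDiag, f z.1 z.2) / (n * (n - 1) : ℝ)) ^ 2)
            / (n : ℝ)|
      ≤ 2 * Real.sqrt ((∑ i, ((∑ j ∈ univ.erase i, f i j) / ((n : ℝ) - 1)
            - (∑ z ∈ (univ : Finset (Fin n)).offDiag, f z.1 z.2) / (n * (n - 1) : ℝ)) ^ 2)
              / (n : ℝ)
          * (t ^ 2 * ((∑ i, ((∑ j ∈ univ.erase i, g i j) / ((n : ℝ) - 1)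
            - (∑ z ∈ (univ : Finset (Fin n)).offDiag, g z.1 z.2) / (n * (n - 1) : ℝ)) ^ 2)
              / (n : ℝ))))
        + t ^ 2 * ((∑ i, ((∑ j ∈ univ.erase i, g i j) / ((n : ℝ) - 1)
            - (∑ z ∈ (univ : Finset (Fin n)).offDiag, g z.1 z.2) / (n * (n - 1) : ℝ)) ^ 2)
              / (n : ℝ)) := by
  simp only [rowDev_add_smul f g e t hfg]
  have hb : ∀ d : Fin n → ℝ,
      (∑ i, (t * d i) ^ 2) / (n : ℝ) = t ^ 2 * ((∑ i, d i ^ 2) / (n : ℝ)) := by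
    intro d
    rw [show ∑ i, (t * d i) ^ 2 = t ^ 2 * ∑ i, d i ^ 2 by
      rw [mul_sum]
      exact sum_congr rfl fun i _ => by ring]
    ring
  have h := abs_meanSq_add_sub_meanSq_le hn
    (fun i => (∑ j ∈ univ.erase i, f i j) / ((n : ℝ) - 1)
      - (∑ z ∈ (univ : Finset (Fin n)).offDiag, f z.1 z.2) / (n * (n - 1) : ℝ))
    (fun i => t * ((∑ j ∈ univ.erase i, g i j) / ((n : ℝ) - 1)
      - (∑ z ∈ (univ : Finset (Fin n)).offDiag, g z.1 z.2) / (n * (n - 1) : ℝ)))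
  beta_reduce at h
  rw [hb] at h
  exact h

/-- **The row deviations are homogeneous in the kernel**: for `e = c·f` entrywise,
`Ĥᵢ(e) − U(e) = c·(Ĥᵢ(f) − U(f))`. [ours] -/
theorem rowDev_smul (f e : Fin n → Fin n → ℝ) (c : ℝ) (hcf : ∀ i j, e i j = c * f i j)
    (i : Fin n) :
    (∑ j ∈ univ.erase i, e i j) / ((n : ℝ) - 1)
        - (∑ z ∈ (univ : Finset (Fin n)).offDiag, e z.1 z.2) / (n * (n - 1) : ℝ)
      = c * ((∑ j ∈ univ.erase i, f i j) / ((n : ℝ) - 1)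
          - (∑ z ∈ (univ : Finset (Fin n)).offDiag, f z.1 z.2) / (n * (n - 1) : ℝ)) := by
  have h1 : ∑ j ∈ univ.erase i, e i j = c * ∑ j ∈ univ.erase i, f i j := by
    rw [mul_sum]
    exact sum_congr rfl fun j _ => hcf i j
  have h2 : ∑ z ∈ (univ : Finset (Fin n)).offDiag, e z.1 z.2
      = c * ∑ z ∈ (univ : Finset (Fin n)).offDiag, f z.1 z.2 := by
    rw [mul_sum]
    exact sum_congr rfl fun z _ => hcf z.1 z.2
  rw [h1, h2]
  ring

/-- **Scaling**: for `e = c·f` entrywise, `V̂(e) = c²·V̂(f)`. [ours] -/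
theorem senVariance_smul (f e : Fin n → Fin n → ℝ) (c : ℝ) (hcf : ∀ i j, e i j = c * f i j) :
    (∑ i, ((∑ j ∈ univ.erase i, e i j) / ((n : ℝ) - 1)
        - (∑ z ∈ (univ : Finset (Fin n)).offDiag, e z.1 z.2) / (n * (n - 1) : ℝ)) ^ 2) / (n : ℝ)
      = c ^ 2 * ((∑ i, ((∑ j ∈ univ.erase i, f i j) / ((n : ℝ) - 1)
        - (∑ z ∈ (univ : Finset (Fin n)).offDiag, f z.1 z.2) / (n * (n - 1) : ℝ)) ^ 2)
          / (n : ℝ)) := by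
  simp only [rowDev_smul f e c hcf]
  rw [show ∑ i, (c * ((∑ j ∈ univ.erase i, f i j) / ((n : ℝ) - 1)
      - (∑ z ∈ (univ : Finset (Fin n)).offDiag, f z.1 z.2) / (n * (n - 1) : ℝ))) ^ 2
      = c ^ 2 * ∑ i, ((∑ j ∈ univ.erase i, f i j) / ((n : ℝ) - 1)
        - (∑ z ∈ (univ : Finset (Fin n)).offDiag, f z.1 z.2) / (n * (n - 1) : ℝ)) ^ 2 by
    rw [mul_sum]
    exact sum_congr rfl fun i _ => by ring]
  ring

/-- Sen's estimator is non-negative. [ours] -/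
theorem senVariance_nonneg (f : Fin n → Fin n → ℝ) :
    0 ≤ (∑ i, ((∑ j ∈ univ.erase i, f i j) / ((n : ℝ) - 1)
        - (∑ z ∈ (univ : Finset (Fin n)).offDiag, f z.1 z.2) / (n * (n - 1) : ℝ)) ^ 2)
          / (n : ℝ) :=
  div_nonneg (sum_nonneg fun _ _ => sq_nonneg _) (Nat.cast_nonneg n)

/-- **The squeeze along a subsequence** (real analysis): `Vf_{φ(k)} → ζ`, `Vg_{φ(k)} → ζ'`,
`T_{φ(k)} → 0`, and `|Wₘ − Vfₘ| ≤ 2√(Vfₘ·Tₘ²Vgₘ) + Tₘ²Vgₘ` for all `m` ⇒ `W_{φ(k)} → ζ`.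
[ours] -/
theorem tendsto_senVariance_perturb_along {W Vf Vg T : ℕ → ℝ} {φ : ℕ → ℕ} {ζ ζ' : ℝ}
    (hVf : Tendsto (fun k => Vf (φ k)) atTop (𝓝 ζ))
    (hVg : Tendsto (fun k => Vg (φ k)) atTop (𝓝 ζ'))
    (hT : Tendsto (fun k => T (φ k)) atTop (𝓝 0))
    (hbound : ∀ m, |W m - Vf m| ≤ 2 * Real.sqrt (Vf m * (T m ^ 2 * Vg m)) + T m ^ 2 * Vg m) :
    Tendsto (fun k => W (φ k)) atTop (𝓝 ζ) := by
  have hB : Tendsto (fun k => 2 * Real.sqrt (Vf (φ k) * (T (φ k) ^ 2 * Vg (φ k)))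
      + T (φ k) ^ 2 * Vg (φ k)) atTop (𝓝 0) := by
    have h := ((hVf.mul ((hT.pow 2).mul hVg)).sqrt.const_mul 2).add ((hT.pow 2).mul hVg)
    simpa using h
  have hdiff : Tendsto (fun k => W (φ k) - Vf (φ k)) atTop (𝓝 0) :=
    squeeze_zero_norm' (Eventually.of_forall fun k => by
      rw [Real.norm_eq_abs]
      exact hbound _) hB
  simpa using hdiff.add hVf

end Deterministic

/-! ## §2 The transfer to convergence in probability -/

section Transfer

variable {Ω : Type*} [MeasurableSpace Ω] {P : Measure Ω} [IsFiniteMeasure P]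

/-- **Sen's estimator with a vanishing random perturbation of the kernel.**  Random sequences
`Vf → ζ` and `Vg → ζ'` in probability, `T → 0` almost surely, `W` (strongly) measurable with
`|Wₙ − Vfₙ| ≤ 2√(Vfₙ·Tₙ²Vgₙ) + Tₙ²Vgₙ` pointwise ⇒ `W → ζ` in probability. [ours] (nested
subsequence criterion) -/
theorem tendstoInMeasure_senVariance_perturb {W Vf Vg T : ℕ → Ω → ℝ} {ζ ζ' : ℝ}
    (hWm : ∀ n, AEStronglyMeasurable (W n) P)
    (hVf : TendstoInMeasure P Vf atTop (fun _ => ζ))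
    (hVg : TendstoInMeasure P Vg atTop (fun _ => ζ'))
    (hT : ∀ᵐ ω ∂P, Tendsto (fun n => T n ω) atTop (𝓝 0))
    (hbound : ∀ n ω, |W n ω - Vf n ω|
      ≤ 2 * Real.sqrt (Vf n ω * (T n ω ^ 2 * Vg n ω)) + T n ω ^ 2 * Vg n ω) :
    TendstoInMeasure P W atTop (fun _ => ζ) := by
  rw [exists_seq_tendstoInMeasure_atTop_iff hWm]
  intro ns hns
  -- a sub-subsequence along which `Vf` converges almost surely …
  obtain ⟨ns₁, hns₁, hVf₁⟩ := (hVf.comp hns.tendsto_atTop).exists_seq_tendsto_ae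
  -- … and a further one along which `Vg` does too
  obtain ⟨ns₂, hns₂, hVg₂⟩ :=
    (hVg.comp (hns.tendsto_atTop.comp hns₁.tendsto_atTop)).exists_seq_tendsto_ae
  refine ⟨fun k => ns₁ (ns₂ k), hns₁.comp hns₂, ?_⟩
  filter_upwards [hVf₁, hVg₂, hT] with ω hVfω hVgω hTω
  have hφ : Tendsto (fun k => ns (ns₁ (ns₂ k))) atTop atTop :=
    hns.tendsto_atTop.comp (hns₁.tendsto_atTop.comp hns₂.tendsto_atTop)
  exact tendsto_senVariance_perturb_along (φ := fun k => ns (ns₁ (ns₂ k)))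
    (hVfω.comp hns₂.tendsto_atTop) hVgω (hTω.comp hφ) fun m => hbound m ω

end Transfer

end Summit.Ventures.LatticeQCDFlow.Scoring.CardConsistency

end
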